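import Literature.AlgebraicGeometry.ShimuraVarieties.UnitaryCurveComplexSliceHeckeOrbitExt   -- ★ p849682 (LA4-p03): the two-morphism density head + E5 frame, `ShimuraSetGS`, `RecordSystemGS`
import HarnessLib

/-!
# (β1) CONTINUITY-ONLY DENSITY on the unitary Shimura curve: a morphism՚s point map and a map `Sh_K(ℂ) → X(ℂ)` that is CONTINUOUS IN THE CONE
# VARIABLE piece by piece agree everywhere as soon as they agree on ONE Hecke orbit ([Milne 2005] Lemma 13.5 + proof of Thm. 13.6, p. 118)

Topic `AlgebraicGeometry/ShimuraVarieties`, namespace `…ShimuraVarieties.UnitaryCanonicalModel`.  THEOREMS ONLY (no definition, no instance, no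
notation, no named fact, no `sorry`).  Cell `hodgecm-mathlib` (D-0151), P6 «MOD programme», crux hLiu418 (stmt-HodgeConjecture-24832, `--supports`,
count-neutral), line «L4», X-LEAF `Lines/F0_P6a_EExports.lean` socket `stub_ESHEET`, (S8) closer `Lines/F0_P6a_StubESHEET.lean` organ
`stub_SHEET` (#29 B′; LA4-plan (g2) DEAL #36 → LA4-p02 (g2) «(β1) CONTINUITY-ONLY DENSITY»; DEAL #35 (LA4-p01 (g3)) delivers the
continuity hypothesis in the SHAPE fixed here).

THE POINT.  ★ p849682 `RecordSystemGS.sliceComplex_ext_of_heckeOrbit` compares TWO `ℂ`-MORPHISMS `(M_K)_τ → M_ℂ`.  In the sheet line the second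
protagonist — the point map `[v, aK] ↦ pts⁻¹[J v, b(a)·ũ_V(1,z)]` of the Serre-twisted family, written through the chart՚s uniformisations
(`C.hZ`, `C.unif_cont`, `C.pts_unif`, `C.junction`) — is, at the moment it is compared, NOT YET known to be the point map of a morphism; it is only
CONTINUOUS, and continuous in the cheapest currency the chart offers: for each FIXED adelic coordinate `a`, `v ↦ f₂ [v, aK]` is continuous on the
negative cone `𝔻 = negCone(J⋆^τ)` (a period map composed with a disc uniformisation).  Since the level `K` is OPEN, `U(J⋆)(𝔸_f)/K` is DISCRETE and
`Sh_K(ℂ) = (𝔻 × U(𝔸_f)/K)/∼` carries the quotient topology (★ `ShimuraSetGS`, an `abbrev` of a `Quotient`), this piecewise continuity IS continuity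
on `Sh_K(ℂ)` (§1); the Hecke orbit `{[v, bK] : b}` of one negative vector is dense (★ `ShimuraSetGS.dense_heckeOrbit`, Milne Lemma 13.5) and the
target `X(ℂ)` of a separated `X` is Hausdorff (★ `ComplexPoints.t2Space_of_isSeparated`), so two such maps agreeing on the orbit agree (§1), in
particular the (automatically continuous, ★ `AlgPoints.continuous_map`) point map of a morphism `T : (M_K)_τ → X` read through any homeomorphism
`e : (M_K)_τ(ℂ) ≃ₜ Sh_K(ℂ)` and such an `f₂` (§2) — also after a continuous reading `π : X(ℂ) → Y` of the target (the `pts` ∕ `.left ≫ pr₁`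
currencies of ★ E5 §2 and ★ p849947), and in E5՚s `pts`-currency through the junction `he` of ★ `RecordSystemGS.gal_comp_sliceComplex`.

* §1 `ShimuraSetGS.continuous_of_forall_continuous_mk` — **THE SHAPE**: `(∀ a, Continuous fun x : ↥𝔻 => f [x, aK]) → Continuous f` for `K` open;
  `ShimuraSetGS.continuous_iff_forall_continuous_mk`; **`ShimuraSetGS.eq_of_forall_mk_eq_of_forall_continuous_mk`** (two piecewise-continuous maps
  into a Hausdorff space agreeing on one Hecke orbit are equal).
* §2 **`RecordSystemGS.map_eq_of_heckeOrbit_of_continuous_mk`** — (β1): morphism `T` vs piecewise-continuous `f₂ : Sh_K(ℂ) → X(ℂ)`, `X` separated over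
  `ℂ`: agreement on one Hecke orbit ⇒ `T(e⁻¹ p) = f₂ p` for every `p`; `…_apply` (at the curve՚s own complex points); `…_comp` (through a continuous
  reading `π : X(ℂ) → Y`, `Y` Hausdorff); `…_pts` (E5 §2 currency `baseChangeEquiv τ (pts⁻¹ [v, bK])`).

## References
* [Milne2005ShimuraVarieties] J. S. Milne, *Introduction to Shimura varieties* (2005; rev. 2017), §13: Lemma 13.5 and Thm. 13.6 (proof) p. 118; Lemma 5.13 p. 57.
* [Deligne1971TravauxShimura] P. Deligne, *Travaux de Shimura* (1971), Prop. 5.2 (density of Hecke orbits).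
* [GortzWedhorn2020] U. Görtz, T. Wedhorn, *Algebraic Geometry I* (2nd ed. 2020), Prop. 9.19 and Rem. 9.20.
-/

set_option autoImplicit false

noncomputable section

open Function MulAction Topology NumberField IsDedekindDomain CategoryTheory CategoryTheory.Limits Matrix
  AlgebraicGeometry
open scoped Matrix ComplexOrder
open Literature.AlgebraicGeometry.Motives Literature.NumberTheory.Automorphic Literature.NumberTheory.Automorphic.UnitaryGroup
open Literature.NumberTheory.Automorphic.Liu2021.AppendixC (C5.OpenCompactSubgroup C5.SmallLevel)

namespace Literature.AlgebraicGeometry.ShimuraVarieties.UnitaryCanonicalModel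

variable {L : Type} [Field L] [NumberField L] [IsCMField L] {Jstar : Matrix (Fin 2) (Fin 2) L} {τ : L →+* ℂ}

/-! ### §1 Piecewise continuity on `Sh_K(ℂ)` IS continuity (open level), and the density consequence -/

section Pieces

variable (K : Subgroup ↥(finAdelic (↥(maximalRealSubfield L)) L (IsCMField.complexConj L) 2 Jstar))

/-- **THE SHAPE — continuity in the cone variable for each fixed adelic coordinate is continuity on `Sh_K(ℂ)`** (`K` OPEN): `Sh_K(ℂ)` is the
quotient of `𝔻 × U(J⋆)(𝔸_f)/K` and `U(𝔸_f)/K` is discrete, so `f` is continuous as soon as every `v ↦ f [v, aK]` is continuous on the negative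
cone `𝔻`. [cite: Milne2005ShimuraVarieties, Lemma 5.13 p. 57] [cite: Deligne1971TravauxShimura, Prop. 5.2] -/
theorem ShimuraSetGS.continuous_of_forall_continuous_mk
    (hK : IsOpen (K : Set ↥(finAdelic (↥(maximalRealSubfield L)) L (IsCMField.complexConj L) 2 Jstar)))
    {Y : Type*} [TopologicalSpace Y] {f : ShimuraSetGS L Jstar τ K → Y}
    (h : ∀ a : ↥(finAdelic (↥(maximalRealSubfield L)) L (IsCMField.complexConj L) 2 Jstar),
      Continuous fun x : ↥(negCone (Jstar.map τ)) => f (ShimuraSetGS.mk L Jstar τ K (x : Fin 2 → ℂ) x.2 a)) :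
    Continuous f := by
  haveI : DiscreteTopology (↥(finAdelic (↥(maximalRealSubfield L)) L (IsCMField.complexConj L) 2 Jstar) ⧸ K) :=
    QuotientGroup.discreteTopology hK
  -- continuity on the quotient = continuity of the lift to `𝔻 × U(𝔸_f)/K`
  refine isQuotientMap_quotient_mk'.continuous_iff.2 ?_
  -- `U(𝔸_f)/K` is discrete: continuity in the cone variable, coset by coset
  refine continuous_prod_of_discrete_right.2 fun q => ?_
  induction q using QuotientGroup.induction_on with
  | H a => exact h a

/-- Continuity on `Sh_K(ℂ)` (`K` open) is EQUIVALENT to continuity of every `v ↦ f [v, aK]` on the cone (the converse by ★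
`ShimuraSetGS.continuous_mk_left`). [cite: Milne2005ShimuraVarieties, Lemma 5.13 p. 57] -/
theorem ShimuraSetGS.continuous_iff_forall_continuous_mk
    (hK : IsOpen (K : Set ↥(finAdelic (↥(maximalRealSubfield L)) L (IsCMField.complexConj L) 2 Jstar)))
    {Y : Type*} [TopologicalSpace Y] (f : ShimuraSetGS L Jstar τ K → Y) :
    Continuous f ↔ ∀ a : ↥(finAdelic (↥(maximalRealSubfield L)) L (IsCMField.complexConj L) 2 Jstar),
      Continuous fun x : ↥(negCone (Jstar.map τ)) => f (ShimuraSetGS.mk L Jstar τ K (x : Fin 2 → ℂ) x.2 a) :=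
  ⟨fun hf a => hf.comp (ShimuraSetGS.continuous_mk_left L Jstar τ K a), ShimuraSetGS.continuous_of_forall_continuous_mk K hK⟩

/-- **TWO PIECEWISE-CONTINUOUS MAPS `Sh_K(ℂ) → Y` INTO A HAUSDORFF SPACE THAT AGREE ON THE HECKE ORBIT OF ONE NEGATIVE VECTOR ARE EQUAL**
(`K` open, `J⋆` `c`-hermitian with unit determinant): ★ `ShimuraSetGS.eq_of_forall_mk_eq` (Milne Lemma 13.5: the orbit `{[v, bK] : b}` is dense) with
the two continuity hypotheses weakened to the SHAPE of `continuous_of_forall_continuous_mk`.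
[cite: Milne2005ShimuraVarieties, Lemma 13.5 and Thm. 13.6 (proof) p. 118] [cite: Deligne1971TravauxShimura, Prop. 5.2] -/
theorem ShimuraSetGS.eq_of_forall_mk_eq_of_forall_continuous_mk (hJ : (Jstar.map (IsCMField.complexConj L))ᵀ = Jstar) (hdet : IsUnit Jstar.det)
    (hK : IsOpen (K : Set ↥(finAdelic (↥(maximalRealSubfield L)) L (IsCMField.complexConj L) 2 Jstar)))
    {v : Fin 2 → ℂ} (hv : v ∈ negCone (Jstar.map τ)) {Y : Type*} [TopologicalSpace Y] [T2Space Y]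
    {f g : ShimuraSetGS L Jstar τ K → Y}
    (hf : ∀ a : ↥(finAdelic (↥(maximalRealSubfield L)) L (IsCMField.complexConj L) 2 Jstar),
      Continuous fun x : ↥(negCone (Jstar.map τ)) => f (ShimuraSetGS.mk L Jstar τ K (x : Fin 2 → ℂ) x.2 a))
    (hg : ∀ a : ↥(finAdelic (↥(maximalRealSubfield L)) L (IsCMField.complexConj L) 2 Jstar),
      Continuous fun x : ↥(negCone (Jstar.map τ)) => g (ShimuraSetGS.mk L Jstar τ K (x : Fin 2 → ℂ) x.2 a))
    (h : ∀ b : ↥(finAdelic (↥(maximalRealSubfield L)) L (IsCMField.complexConj L) 2 Jstar),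
      f (ShimuraSetGS.mk L Jstar τ K v hv b) = g (ShimuraSetGS.mk L Jstar τ K v hv b)) :
    f = g :=
  ShimuraSetGS.eq_of_forall_mk_eq L Jstar τ K hJ hdet hv (ShimuraSetGS.continuous_of_forall_continuous_mk K hK hf)
    (ShimuraSetGS.continuous_of_forall_continuous_mk K hK hg) h

end Pieces

/-! ### §2 (β1) on the record curve: a morphism against a piecewise-continuous map -/

section Curve

variable {K₀ : C5.OpenCompactSubgroup ↥(finAdelic (↥(maximalRealSubfield L)) L (IsCMField.complexConj L) 2 Jstar)}
  (S : RecordSystemGS L Jstar τ K₀) (K : C5.SmallLevel K₀)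

/-- **(β1) — A MORPHISM՚S POINT MAP AND A PIECEWISE-CONTINUOUS MAP THAT AGREE ON ONE HECKE ORBIT AGREE EVERYWHERE.**  `T : (M_K)_τ → X` a
`ℂ`-morphism to a separated `ℂ`-scheme (so `X(ℂ)` is Hausdorff and `P ↦ T(P)` is continuous), `e : (M_K)_τ(ℂ) ≃ₜ Sh_K(ℂ)` any homeomorphism,
`f₂ : Sh_K(ℂ) → X(ℂ)` continuous in the cone variable for each adelic coordinate; if `T(e⁻¹[v, bK]) = f₂ [v, bK]` for all `b` (ONE negative `v`), then
`T(e⁻¹ p) = f₂ p` for EVERY `p ∈ Sh_K(ℂ)`.  The sheet line՚s use: `T :=` the `γ̃`-conjugate of the chart՚s slice, `f₂ :=` the Serre-twisted chart formula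
`[v, aK] ↦ pts⁻¹[J v, b(a)·ũ_V(1,z)]`, agreement on the CM orbit = the forward law ((S2a)+(S2b)).
[cite: Milne2005ShimuraVarieties, Lemma 13.5 and Thm. 13.6 (proof) p. 118] [cite: GortzWedhorn2020, Prop. 9.19 and Rem. 9.20] -/
theorem RecordSystemGS.map_eq_of_heckeOrbit_of_continuous_mk (hJ : (Jstar.map (IsCMField.complexConj L))ᵀ = Jstar) (hdet : IsUnit Jstar.det)
    (e : letI : Algebra L ℂ := τ.toAlgebra
      ComplexPoints ((Motives.baseChangeHom τ).obj (S.M.obj K)) ≃ₜ ShimuraSetGS L Jstar τ K.1.1)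
    {X : SchemeOver ℂ} [IsSeparated X.hom]
    (T : letI : Algebra L ℂ := τ.toAlgebra; (Motives.baseChangeHom τ).obj (S.M.obj K) ⟶ X)
    (f₂ : ShimuraSetGS L Jstar τ K.1.1 → ComplexPoints X)
    (hf₂ : ∀ a : ↥(finAdelic (↥(maximalRealSubfield L)) L (IsCMField.complexConj L) 2 Jstar),
      Continuous fun x : ↥(negCone (Jstar.map τ)) => f₂ (ShimuraSetGS.mk L Jstar τ K.1.1 (x : Fin 2 → ℂ) x.2 a))
    {v : Fin 2 → ℂ} (hv : v ∈ negCone (Jstar.map τ))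
    (h : ∀ b : ↥(finAdelic (↥(maximalRealSubfield L)) L (IsCMField.complexConj L) 2 Jstar),
      AlgPoints.map T (e.symm (ShimuraSetGS.mk L Jstar τ K.1.1 v hv b)) = f₂ (ShimuraSetGS.mk L Jstar τ K.1.1 v hv b)) :
    ∀ p : ShimuraSetGS L Jstar τ K.1.1, AlgPoints.map T (e.symm p) = f₂ p := by
  letI iL : Algebra L ℂ := τ.toAlgebra
  haveI : T2Space (ComplexPoints X) := ComplexPoints.t2Space_of_isSeparated X
  have hfun : (fun p => AlgPoints.map T (e.symm p)) = f₂ :=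
    ShimuraSetGS.eq_of_forall_mk_eq L Jstar τ K.1.1 hJ hdet hv ((AlgPoints.continuous_map T).comp e.symm.continuous)
      (ShimuraSetGS.continuous_of_forall_continuous_mk K.1.1 K.1.2.1 hf₂) h
  exact fun p => congrFun hfun p

/-- (β1) read at the curve՚s own complex points: `T(P) = f₂ (e P)` for every `P ∈ (M_K)_τ(ℂ)`.
[cite: Milne2005ShimuraVarieties, Lemma 13.5 and Thm. 13.6 (proof) p. 118] [cite: GortzWedhorn2020, Prop. 9.19 and Rem. 9.20] -/
theorem RecordSystemGS.map_eq_of_heckeOrbit_of_continuous_mk_apply (hJ : (Jstar.map (IsCMField.complexConj L))ᵀ = Jstar)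
    (hdet : IsUnit Jstar.det)
    (e : letI : Algebra L ℂ := τ.toAlgebra
      ComplexPoints ((Motives.baseChangeHom τ).obj (S.M.obj K)) ≃ₜ ShimuraSetGS L Jstar τ K.1.1)
    {X : SchemeOver ℂ} [IsSeparated X.hom]
    (T : letI : Algebra L ℂ := τ.toAlgebra; (Motives.baseChangeHom τ).obj (S.M.obj K) ⟶ X)
    (f₂ : ShimuraSetGS L Jstar τ K.1.1 → ComplexPoints X)
    (hf₂ : ∀ a : ↥(finAdelic (↥(maximalRealSubfield L)) L (IsCMField.complexConj L) 2 Jstar),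
      Continuous fun x : ↥(negCone (Jstar.map τ)) => f₂ (ShimuraSetGS.mk L Jstar τ K.1.1 (x : Fin 2 → ℂ) x.2 a))
    {v : Fin 2 → ℂ} (hv : v ∈ negCone (Jstar.map τ))
    (h : ∀ b : ↥(finAdelic (↥(maximalRealSubfield L)) L (IsCMField.complexConj L) 2 Jstar),
      AlgPoints.map T (e.symm (ShimuraSetGS.mk L Jstar τ K.1.1 v hv b)) = f₂ (ShimuraSetGS.mk L Jstar τ K.1.1 v hv b)) :
    letI : Algebra L ℂ := τ.toAlgebra
    ∀ P : ComplexPoints ((Motives.baseChangeHom τ).obj (S.M.obj K)), AlgPoints.map T P = f₂ (e P) := by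
  letI iL : Algebra L ℂ := τ.toAlgebra
  intro P
  have h' := S.map_eq_of_heckeOrbit_of_continuous_mk K hJ hdet e T f₂ hf₂ hv h (e P)
  rwa [Homeomorph.symm_apply_apply] at h'

/-- **(β1) THROUGH A CONTINUOUS READING OF THE TARGET** (`π : X(ℂ) → Y` continuous, `Y` Hausdorff — e.g. `pts : 𝓜_ℂ(ℂ) ≃ₜ 𝔖_{g,δ,N}(ℂ)` of the Siegel
record, or `(baseChangeEquiv (ℚ → ℂ) M)⁻¹`, the `.left ≫ pr₁` reading of ★ E5 §2): if `π (T(e⁻¹[v, bK])) = f₂ [v, bK]` on one Hecke orbit and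
`f₂ : Sh_K(ℂ) → Y` is continuous in the cone variable for each adelic coordinate, then `π (T(e⁻¹ p)) = f₂ p` for every `p` (`X` arbitrary here).
[cite: Milne2005ShimuraVarieties, Lemma 13.5 and Thm. 13.6 (proof) p. 118] -/
theorem RecordSystemGS.map_eq_of_heckeOrbit_of_continuous_mk_comp (hJ : (Jstar.map (IsCMField.complexConj L))ᵀ = Jstar)
    (hdet : IsUnit Jstar.det)
    (e : letI : Algebra L ℂ := τ.toAlgebra
      ComplexPoints ((Motives.baseChangeHom τ).obj (S.M.obj K)) ≃ₜ ShimuraSetGS L Jstar τ K.1.1)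
    {X : SchemeOver ℂ} (T : letI : Algebra L ℂ := τ.toAlgebra; (Motives.baseChangeHom τ).obj (S.M.obj K) ⟶ X)
    {Y : Type*} [TopologicalSpace Y] [T2Space Y] (π : ComplexPoints X → Y) (hπ : Continuous π)
    (f₂ : ShimuraSetGS L Jstar τ K.1.1 → Y)
    (hf₂ : ∀ a : ↥(finAdelic (↥(maximalRealSubfield L)) L (IsCMField.complexConj L) 2 Jstar),
      Continuous fun x : ↥(negCone (Jstar.map τ)) => f₂ (ShimuraSetGS.mk L Jstar τ K.1.1 (x : Fin 2 → ℂ) x.2 a))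
    {v : Fin 2 → ℂ} (hv : v ∈ negCone (Jstar.map τ))
    (h : ∀ b : ↥(finAdelic (↥(maximalRealSubfield L)) L (IsCMField.complexConj L) 2 Jstar),
      π (AlgPoints.map T (e.symm (ShimuraSetGS.mk L Jstar τ K.1.1 v hv b))) = f₂ (ShimuraSetGS.mk L Jstar τ K.1.1 v hv b)) :
    ∀ p : ShimuraSetGS L Jstar τ K.1.1, π (AlgPoints.map T (e.symm p)) = f₂ p := by
  letI iL : Algebra L ℂ := τ.toAlgebra
  have hfun : (fun p => π (AlgPoints.map T (e.symm p))) = f₂ :=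
    ShimuraSetGS.eq_of_forall_mk_eq L Jstar τ K.1.1 hJ hdet hv (hπ.comp ((AlgPoints.continuous_map T).comp e.symm.continuous))
      (ShimuraSetGS.continuous_of_forall_continuous_mk K.1.1 K.1.2.1 hf₂) h
  exact fun p => congrFun hfun p

/-- **(β1) IN THE `pts`-CURRENCY OF ★ E5 §2** (`baseChangeEquiv τ (M_K) (pts⁻¹ [v, bK])`, the shape in which ★ `map_conj_eq_sliceComplex_of_recip`
and the (S2a)+(S2b) forward law deliver the agreement), through the junction `he` of ★ `RecordSystemGS.gal_comp_sliceComplex` between `e` and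
`pts`: agreement on one Hecke orbit + piecewise continuity of `f₂` ⇒ `T (baseChangeEquiv τ (M_K) (pts⁻¹ p)) = f₂ p` for every `p`.
[cite: Milne2005ShimuraVarieties, Lemma 13.5 and Thm. 13.6 (proof) p. 118] [cite: GortzWedhorn2020, Prop. 9.19 and Rem. 9.20] -/
theorem RecordSystemGS.map_eq_of_heckeOrbit_of_continuous_mk_pts (hJ : (Jstar.map (IsCMField.complexConj L))ᵀ = Jstar)
    (hdet : IsUnit Jstar.det)
    (e : letI : Algebra L ℂ := τ.toAlgebra
      ComplexPoints ((Motives.baseChangeHom τ).obj (S.M.obj K)) ≃ₜ ShimuraSetGS L Jstar τ K.1.1)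
    (he : letI : Algebra L ℂ := τ.toAlgebra
      ∀ (v : Fin 2 → ℂ) (hv : v ∈ negCone (Jstar.map τ))
        (b : ↥(finAdelic (↥(maximalRealSubfield L)) L (IsCMField.complexConj L) 2 Jstar)),
        e.symm (ShimuraSetGS.mk L Jstar τ K.1.1 v hv b) =
          AlgPoints.baseChangeEquiv τ (S.M.obj K) ((S.pts K).symm (ShimuraSetGS.mk L Jstar τ K.1.1 v hv b)))
    {X : SchemeOver ℂ} [IsSeparated X.hom]
    (T : letI : Algebra L ℂ := τ.toAlgebra; (Motives.baseChangeHom τ).obj (S.M.obj K) ⟶ X)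
    (f₂ : ShimuraSetGS L Jstar τ K.1.1 → ComplexPoints X)
    (hf₂ : ∀ a : ↥(finAdelic (↥(maximalRealSubfield L)) L (IsCMField.complexConj L) 2 Jstar),
      Continuous fun x : ↥(negCone (Jstar.map τ)) => f₂ (ShimuraSetGS.mk L Jstar τ K.1.1 (x : Fin 2 → ℂ) x.2 a))
    {v : Fin 2 → ℂ} (hv : v ∈ negCone (Jstar.map τ))
    (h : letI : Algebra L ℂ := τ.toAlgebra
      ∀ b : ↥(finAdelic (↥(maximalRealSubfield L)) L (IsCMField.complexConj L) 2 Jstar),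
        AlgPoints.map T (AlgPoints.baseChangeEquiv τ (S.M.obj K) ((S.pts K).symm (ShimuraSetGS.mk L Jstar τ K.1.1 v hv b))) =
          f₂ (ShimuraSetGS.mk L Jstar τ K.1.1 v hv b)) :
    letI : Algebra L ℂ := τ.toAlgebra
    ∀ p : ShimuraSetGS L Jstar τ K.1.1, AlgPoints.map T (AlgPoints.baseChangeEquiv τ (S.M.obj K) ((S.pts K).symm p)) = f₂ p := by
  letI iL : Algebra L ℂ := τ.toAlgebra
  -- the junction at every point: `e⁻¹ p = baseChangeEquiv τ (pts⁻¹ p)` (both sides continuous... no: read `p = [w, bK]` and use `he`)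
  have hall := S.map_eq_of_heckeOrbit_of_continuous_mk K hJ hdet e T f₂ hf₂ hv fun b => by rw [he]; exact h b
  intro p
  obtain ⟨w, hw, b, rfl⟩ := ShimuraSetGS.mk_surjective L Jstar τ K.1.1 p
  rw [← he]
  exact hall _

end Curve

end Literature.AlgebraicGeometry.ShimuraVarieties.UnitaryCanonicalModel

end
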